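import Literature.MathematicalPhysics.QuantumFieldTheory.BalabanImbrieJaffe1984to88.BIJ85Sigma421Torus
import Literature.MathematicalPhysics.QuantumFieldTheory.BalabanImbrieJaffe1984to88.BIJ85Sigma422Equivariance
import Literature.MathematicalPhysics.QuantumFieldTheory.BalabanImbrieJaffe1984to88.BIJ85NoZeroModes309Torus
import Literature.MathematicalPhysics.QuantumFieldTheory.Balaban1983to89.B12GaugeFixInvariance269

/-!
# `BalabanImbrieJaffe1984to88.BIJ85SigmaTranslationInvariance` — T. Bałaban, J. Imbrie, A. Jaffe, *Renormalization of the Higgs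
model: minimizers, propagators and the stability of mean field theory*, Commun. Math. Phys. **97** (1985) 299–329
[BalabanImbrieJaffe1985]: Sect. 7.1 p. 321, *"Since we study periodic boundary conditions, σ_k is translation invariant"* —
PROVED ON THE TORUS MODEL of the series: the unit-lattice translations `t ∈ T^{(k)}` act on the η-lattice `T^{(0)}` by `L^k·t`,
COMMUTE with every ingredient of (4.1.1)–(4.2.2) (the averages `Q_k`, the axial gauge conditions `δ_{k,Ax}`, the curl `∂`, the
pull-back `Q^{e*}_k`), carry the support `δ(Q_kA)δ_{k,Ax}(A)` of (4.1.1) into itself, and therefore commute with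
`σ_k = Q^e_k(I − ∂G_{k,Ax}∂^*)Q^{e*}_k` (4.2.2)

statement-level skeleton of published theorems with citation tags; proofs where landed; nothing here is a claim about the Yang–Mills mass gap

PDF held: `paper:balaban1985-cmp97-bij-higgs-minimizers` (journal page = PDF page + 298); p. 321 [PDF 23] and p. 309–310 [PDF
11–12] read on the text layer and the renders `…/renders/bij1985/1985-cmp97-bij-higgs-minimizers-p012-x2.png`, `…-p023-x2.png`.

CITATION HEADER (lean-in-tree rule).  Part of the lit-balaban TYPED SKELETON (HOME `run/shared/lean/pub/lit-balaban/`).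
WHAT IS REPRODUCED = the translation-invariance sentence of SKELETON row **C1.Thm7.1.1** (p. 321) for the torus σ_k of row
**C1.Eq4.2.1-4.2.2** (`BIJ85Sigma421Torus.sigmaTorus`, seat p30 g3) — precisely the clause seat p27 g4's
`BIJ85Sigma422Equivariance` (p249863, the abstract equivariance of `sigmaOp` under isometries preserving the data) leaves open:
*"NOT CLAIMED: the verification that the unit-lattice translations of the torus model `BIJ85Sigma421Torus.sigmaTorus` preserve
`V411` and intertwine `curlOp`, `QesOp` (an input for `BIJ85Eq712Plancherel.IsTranslInv`)"*.  Phase-2 proof seat p33 gen 3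
(unit `lit-balaban-p33`; own lineage: the (4.1.1) support / no-zero-modes files `BIJ85NoZeroModes309Torus…`); TAKING line
HOME/STATUS.md 2026-08-21T05:44:59Z; owner r15, referee ref-5.

THE PRINTED TEXT (verbatim, p. 321 [PDF 23]).  *"The strategy of the proof is to give an explicit formula for σ_k, which we
then analyze in detail. Since we study periodic boundary conditions, σ_k is translation invariant. Thus it is natural to study
σ_k as a multiplication operator σ_k(p) in the Fourier transform representation."*  The objects (p. 309–310 [PDF 11–12]):
*"The averaging operator Q_k is the k-fold composition of the 1-step averaging operators Q for bond variables, Q_k = (Q)^k …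
the axial gauge is fixed by the delta function δ_{k,Ax}(A) ≡ Π_{j=0}^{k−1}δ_{Ax}(Q_jA). (4.1.2)"*,
*"σ_k = Q^e_k(I − ∂G_{k,Ax}∂^*)Q^{e*}_k. (4.2.2)"*.

SETTING.  The tori `T^{(j)}` = `Site P j` of `Setup` with their coordinatewise addition (`TorusLimitAxioms`: `x + a`,
`PBond.translate`, `Plaq.translate`, `…Equiv`); the fine vector `L·a ∈ T^{(j)}` of a coarse translation `a ∈ T^{(j+1)}` is
`T4Covariance`'s `Site.scale a` (`emb (y + a) = emb y + scale a`), and `L^k·t ∈ T^{(0)}` for `t ∈ T^{(k)}` is `Site.scaleTo k t`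
(recursion `scaleTo (k+1) t = scaleTo k (scale t)`, along which every k-level statement is an induction); the V1 calculus
`LatticeFieldCalculus` (`bondAvg` = Q, `siteAvg` = Q′, `bondAvgIter k` = Q_k, `IsAxial`, `stairSum` = A(Γ_{y,x}), `curl` = ∂);
`deltaAx`/`constraint411`/`V411`/`curlOp`/`toE` of p09's `BIJ85AxialPropagator411`; `QestarIter` (= Q^{e*}_k over p31's
`torusEdgeCells`), `QesOp`, `UnitPlaqSpace`, `sigmaTorus` of p30 g3's `BIJ85Eq531Inputs`/`BIJ85Sigma421Torus`; r09's
`B12GaugeFixInvariance269.blockSite_add`/`blockOf_add_scale` (blocks go to blocks).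

WHAT IS PROVED (0 `sorry`, standard axioms).  The six `def`s are the translation ACTIONS (plumbing with bodies, no `Prop`):
`translV`/`translS`/`translP` on bond / site / plaquette functions, and the linear ISOMETRIES `bondTransl v : BondSpace P ≃ₗᵢ
BondSpace P`, `plaqTransl v`, `unitPlaqTransl k t` (`LinearIsometryEquiv.piLpCongrLeft` of the translation bijections) — the
`U_E`, `U_F`, `U_{F′}` of p27's `sigmaOp_equivariant`.
* §1 one level (`a ∈ T^{(j+1)}` acting by `L·a`): `segSum_transl`, `runSum_transl`, `mixSite_add`, `stairSum_transl`
  (`(τ_vA)(Γ_{y,x}) = A(Γ_{y+v,x+v})`), **`bondAvg_transl`** (`Q(τ_{La}A) = τ_a(QA)`), `siteAvg_transl`, **`isAxial_transl_iff`**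
  (the axial gauge is carried into itself: block base points go to base points), `curl_transl`;
* §2 k levels (`t ∈ T^{(k)}` acting by `L^k·t`): **`bondAvgIter_transl`** (`Q_k(τ_{L^kt}A) = τ_t(Q_kA)`), `siteAvgIter_transl`,
  **`deltaAx_transl_iff`**, **`constraint411_transl_iff`** (the support of (4.1.1) is invariant);
* §3 `mem_edgeB_transl_iff`, `edgeQstar_transl`, **`QestarIter_transl`** (`Q^{e*}_k(τ_tg) = τ_{L^kt}(Q^{e*}_kg)`; standing range
  `k ≤ m + K`, where blocks are genuine blocks);
* §4 the three hypotheses of p27's `sigmaOp_equivariant` DISCHARGED on the torus — **`bondTransl_mem_V411_iff`** (`U_E V411 =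
  V411`), **`curlOp_bondTransl`** (`∂U_E = U_F∂`), **`QesOp_unitPlaqTransl`** (`Q^{e*}_kU_{F′} = U_FQ^{e*}_k`) — and, with the
  no-zero-modes input of gen 2's `noZeroModes_V411_holds` (`k ≤ m + K`, `η^d = w > 0`, `c ≠ 0`): **`sigmaTorus_translate`**
  (`σ_k(τ_tf) = τ_t(σ_kf)`), `sigmaTorus_translate_apply`, **`inner_sigmaTorus_translate`** (`⟨τ_tf, σ_kτ_tg⟩ = ⟨f, σ_kg⟩`),
  `unitPlaqTransl_single`, and the KERNEL statement **`sigmaTorus_matrix_translate`** (`σ_k(p + t, q + t) = σ_k(p, q)`, the shape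
  of p27's `BIJ85Eq712Plancherel.IsTranslInv`: σ_k is a convolution operator on the unit torus `T^{(k)}`).
HONEST SCOPE.  Only translations by unit-lattice vectors (= block-lattice vectors on every finer torus) — the symmetry the block
structure admits; rotations / reflections ([Balaban1987RG1] (2.17)) are not treated; the identification of `Plaq P k` with
p27's carrier `Tor N × m` (N = 2L^{m+K−k}, m = the d(d−1)/2 plaquette orientations) is not made here.  Nothing analytic.
-/

namespace Literature.MathematicalPhysics.QuantumFieldTheory.BalabanImbrieJaffe1984to88.BIJ85SigmaTranslationInvariance

open Literature.MathematicalPhysics.QuantumFieldTheory.Balaban1983to89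
open LatticeFieldCalculus BIJ85AxialPropagator411 B12GaugeFixInvariance269

noncomputable section

variable {P : Params} {j : ℕ} {V : Type*}

/-! ## §0  The translation actions on bond, site and plaquette fields -/

/-- The translate of a bond field of `T^{(j)}` by a lattice vector `v`: `(τ_vA)(b) = A(b + v)`.
[cite: BalabanImbrieJaffe1985, Thm. 7.1.1 p.321] -/
def translV (v : Balaban1983to89.Site P j) (A : VecField P j V) : VecField P j V := fun b => A (b.translate v)

/-- The translate of a site function of `T^{(j)}`: `(τ_vλ)(x) = λ(x + v)`. [cite: BalabanImbrieJaffe1985, Thm. 7.1.1 p.321] -/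
def translS (v : Balaban1983to89.Site P j) (f : SiteField P j V) : SiteField P j V := fun x => f (x + v)

/-- The translate of a plaquette function of `T^{(j)}`: `(τ_vg)(p) = g(p + v)`. [cite: BalabanImbrieJaffe1985, Thm. 7.1.1 p.321] -/
def translP (v : Balaban1983to89.Site P j) (g : Plaq P j → V) : Plaq P j → V := fun p => g (p.translate v)

/-- `translV` evaluated. [cite: BalabanImbrieJaffe1985, Thm. 7.1.1 p.321] -/
@[simp] theorem translV_apply (v : Balaban1983to89.Site P j) (A : VecField P j V) (b : PBond P j) :
    translV v A b = A (b.translate v) := rfl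

/-- `translS` evaluated. [cite: BalabanImbrieJaffe1985, Thm. 7.1.1 p.321] -/
@[simp] theorem translS_apply (v : Balaban1983to89.Site P j) (f : SiteField P j V) (x : Balaban1983to89.Site P j) :
    translS v f x = f (x + v) := rfl

/-- `translP` evaluated. [cite: BalabanImbrieJaffe1985, Thm. 7.1.1 p.321] -/
@[simp] theorem translP_apply (v : Balaban1983to89.Site P j) (g : Plaq P j → V) (p : Plaq P j) :
    translP v g p = g (p.translate v) := rfl

/-- Group law: `τ_u(τ_vA) = τ_{u+v}A`. [cite: BalabanImbrieJaffe1985, Thm. 7.1.1 p.321] -/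
theorem translV_translV (u v : Balaban1983to89.Site P j) (A : VecField P j V) :
    translV u (translV v A) = translV (u + v) A := by
  funext b
  simp only [translV_apply, PBond.translate_translate]

/-- `τ_0A = A`. [cite: BalabanImbrieJaffe1985, Thm. 7.1.1 p.321] -/
theorem translV_zero (A : VecField P j V) : translV 0 A = A := by
  funext b
  obtain ⟨x, μ⟩ := b
  simp [translV, PBond.translate]

/-- `τ_v` is injective: `τ_vA = 0 ↔ A = 0`. [cite: BalabanImbrieJaffe1985, Thm. 7.1.1 p.321] -/
theorem translV_eq_zero_iff [AddCommGroup V] (v : Balaban1983to89.Site P j) (A : VecField P j V) :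
    translV v A = 0 ↔ A = 0 := by
  constructor
  · intro h
    have h2 : translV (-v) (translV v A) = A := by rw [translV_translV, neg_add_cancel, translV_zero]
    rw [← h2, h]
    rfl
  · rintro rfl
    rfl

/-- `τ_v` is additive. [cite: BalabanImbrieJaffe1985, Thm. 7.1.1 p.321] -/
theorem translV_add [AddCommGroup V] (v : Balaban1983to89.Site P j) (A B : VecField P j V) :
    translV v (A + B) = translV v A + translV v B := rfl

/-- `τ_v` is homogeneous. [cite: BalabanImbrieJaffe1985, Thm. 7.1.1 p.321] -/
theorem translV_smul [AddCommGroup V] [Module ℝ V] (v : Balaban1983to89.Site P j) (c : ℝ) (A : VecField P j V) :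
    translV v (c • A) = c • translV v A := rfl

/-- Group law for plaquette functions. [cite: BalabanImbrieJaffe1985, Thm. 7.1.1 p.321] -/
theorem translP_translP (u v : Balaban1983to89.Site P j) (g : Plaq P j → V) :
    translP u (translP v g) = translP (u + v) g := by
  funext p
  obtain ⟨x, μ, ν, h⟩ := p
  simp [translP, Plaq.translate, add_assoc]

/-- `τ_0g = g` for plaquette functions. [cite: BalabanImbrieJaffe1985, Thm. 7.1.1 p.321] -/
theorem translP_zero (g : Plaq P j → V) : translP 0 g = g := by
  funext p
  obtain ⟨x, μ, ν, h⟩ := p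
  simp [translP, Plaq.translate]

/-! ## §1  One level: straight runs, staircases, the averages Q, Q′ and the axial gauge -/

/-- A backward step of the straight run translates (the bonds `⟨x − (t+1)e_μ, x − te_μ⟩` of `runSum`). [folklore] -/
private theorem translate_update_sub (x v : Balaban1983to89.Site P j) (μ : Fin P.d) (c : ZMod (P.sitesPerDir j)) :
    (⟨Function.update x μ (x μ - c), μ⟩ : PBond P j).translate v = ⟨Function.update (x + v) μ ((x + v) μ - c), μ⟩ := by
  simp only [PBond.translate, PBond.mk.injEq, and_true]
  funext ν
  rw [Site.add_apply]
  by_cases h : ν = μ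
  · subst h
    rw [Function.update_self, Function.update_self, Site.add_apply]
    ring
  · rw [Function.update_of_ne h, Function.update_of_ne h, Site.add_apply]

section OneLevel

variable [AddCommGroup V]

/-- The straight run of (1.7)/(2.5) translates: `(x + v) + te_μ = (x + te_μ) + v`. [cite: BalabanImbrieJaffe1985, (2.5) p.302] -/
theorem runSite_add (x v : Balaban1983to89.Site P j) (μ : Fin P.d) (t : ℕ) :
    runSite (x + v) μ t = runSite x μ t + v := by
  funext ν
  rw [Site.add_apply]
  simp only [runSite]
  by_cases h : ν = μ
  · subst h
    rw [Function.update_self, Function.update_self, Site.add_apply]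
    ring
  · rw [Function.update_of_ne h, Function.update_of_ne h, Site.add_apply]

/-- `A([x, x + ne_μ])` of a translated field: `(τ_vA)([x, x + ne_μ]) = A([x + v, x + v + ne_μ])`. [cite: BalabanImbrieJaffe1985, (2.5) p.302] -/
theorem segSum_transl (v : Balaban1983to89.Site P j) (A : VecField P j V) (x : Balaban1983to89.Site P j) (μ : Fin P.d) (n : ℕ) :
    segSum (translV v A) x μ n = segSum A (x + v) μ n := by
  unfold segSum
  refine Finset.sum_congr rfl fun t _ => ?_
  simp only [translV_apply, runBond, PBond.translate]
  rw [runSite_add]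

/-- The signed run sum translates likewise (both orientations). [cite: BalabanImbrieJaffe1985, (2.5) p.302] -/
theorem runSum_transl (v : Balaban1983to89.Site P j) (A : VecField P j V) (x : Balaban1983to89.Site P j) (μ : Fin P.d) (n : ℤ) :
    runSum (translV v A) x μ n = runSum A (x + v) μ n := by
  cases n with
  | ofNat n =>
    show segSum (translV v A) x μ n = segSum A (x + v) μ n
    exact segSum_transl v A x μ n
  | negSucc n =>
    simp only [runSum, translV_apply, translate_update_sub]

/-- The corners of the staircase translate: `mixSite μ (y + v) (x + v) = mixSite μ y x + v`. [cite: BalabanImbrieJaffe1985, (2.5) p.302] -/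
theorem mixSite_add (μ : Fin P.d) (y x v : Balaban1983to89.Site P j) : mixSite μ (y + v) (x + v) = mixSite μ y x + v := by
  funext ν
  simp only [mixSite, Site.add_apply]
  split_ifs <;> rfl

/-- **The staircase contours translate**: `(τ_vA)(Γ_{y,x}) = A(Γ_{y+v,x+v})` (the contours Γ of (2.5)/p. 302–303 are defined
by coordinate differences, which a translation preserves). [cite: BalabanImbrieJaffe1985, (2.5) p.302] -/
theorem stairSum_transl (v : Balaban1983to89.Site P j) (A : VecField P j V) (y x : Balaban1983to89.Site P j) :
    stairSum (translV v A) y x = stairSum A (y + v) (x + v) := by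
  unfold stairSum
  refine Finset.sum_congr rfl fun μ _ => ?_
  rw [runSum_transl, mixSite_add]
  congr 2
  simp only [Site.add_apply]
  ring

/-- **`Q` commutes with the block-lattice translations**: for `a ∈ T^{(j+1)}`, `Q(τ_{La}A) = τ_a(QA)` — the one-step bond average
(2.13) (the tree's `bondAvg`, [Balaban1984PropagatorsI] (1.11)) of the field translated by the fine vector `L·a` is the translate by
`a` of the average (the blocks go to blocks: `blockSite (c₋ + a) r = blockSite c₋ r + L·a`). [cite: BalabanImbrieJaffe1985, (2.13) p.304] -/
theorem bondAvg_transl [Module ℝ V] (a : Balaban1983to89.Site P (j + 1)) (A : VecField P j V) :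
    bondAvg (translV (Site.scale a) A) = translV a (bondAvg A) := by
  funext c
  simp only [bondAvg, translV_apply]
  congr 1
  refine Finset.sum_congr rfl fun r _ => ?_
  rw [segSum_transl]
  simp only [PBond.translate, blockSite_add]

/-- `Q′` commutes with the block-lattice translations: `Q′(τ_{La}λ) = τ_a(Q′λ)` (ordinary block average of site functions,
[Balaban1984PropagatorsI] (1.13); p. 303 *"Qφ is the ordinary average of φ"*). [cite: BalabanImbrieJaffe1985, (2.6) p.303] -/
theorem siteAvg_transl [Module ℝ V] (a : Balaban1983to89.Site P (j + 1)) (f : SiteField P j V) :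
    siteAvg (translS (Site.scale a) f) = translS a (siteAvg f) := by
  funext y
  simp only [siteAvg, translS_apply, blockSite_add]

/-- **The axial gauge is carried into itself by the block-lattice translations**: `τ_{La}A` is axial iff `A` is — the trees
`T(y)` of (3.4) (staircases from the base point of `B(y)`, the tree's `IsAxial`) go to the trees `T(y + a)` (`emb (y + a) =
emb y + L·a`, `blockSite (y + a) r = blockSite y r + L·a`). [cite: BalabanImbrieJaffe1985, (3.4) p.306] -/
theorem isAxial_transl_iff (a : Balaban1983to89.Site P (j + 1)) (A : VecField P j V) :
    IsAxial (translV (Site.scale a) A) ↔ IsAxial A := by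
  have key : ∀ (y : Balaban1983to89.Site P (j + 1)) (r : Fin P.d → Fin P.L),
      stairSum (translV (Site.scale a) A) (emb y) (Site.blockSite y r) = stairSum A (emb (y + a)) (Site.blockSite (y + a) r) := by
    intro y r
    rw [stairSum_transl, Site.emb_add, blockSite_add]
  have key2 : ∀ (y : Balaban1983to89.Site P (j + 1)) (r : Fin P.d → Fin P.L),
      Site.blockSite (y + a) r ≠ emb (y + a) ↔ Site.blockSite y r ≠ emb y := by
    intro y r
    rw [blockSite_add, Site.emb_add]
    exact (add_left_inj _).not
  unfold IsAxial
  constructor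
  · intro h y r hne
    have h' := h (y - a) r (by rw [← key2, sub_add_cancel]; exact hne)
    rwa [key, sub_add_cancel] at h'
  · intro h y r hne
    rw [key]
    exact h (y + a) r ((key2 y r).2 hne)

/-- **`∂` commutes with every translation**: `(∂(τ_vA))(p) = (∂A)(p + v)`. [cite: BalabanImbrieJaffe1985, (4.2.2) p.310] -/
theorem curl_transl [Module ℝ V] (c : ℝ) (v : Balaban1983to89.Site P j) (A : VecField P j V) (p : Plaq P j) :
    curl c (translV v A) p = curl c A (p.translate v) := by
  simp only [curl, translV_apply, PBond.translate, Plaq.translate, Site.shift_add]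

end OneLevel

/-! ## §2  k levels: `Q_k`, `Q′_k`, `δ_{k,Ax}` and the support of (4.1.1) under the unit-lattice translations -/

section Iterated

variable [AddCommGroup V] [Module ℝ V]

/-- **`Q_k` commutes with the unit-lattice translations**: for `t ∈ T^{(k)}` acting on `T^{(0)}` by `L^k·t` (`Site.scaleTo k t`),
`Q_k(τ_{L^kt}A) = τ_t(Q_kA)` — by induction on k, *"Q_k = (Q)^k"* (p. 309). [cite: BalabanImbrieJaffe1985, (2.13) p.304] -/
theorem bondAvgIter_transl : ∀ (k : ℕ) (t : Balaban1983to89.Site P k) (A : VecField P 0 V),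
    bondAvgIter k (translV (Site.scaleTo k t) A) = translV t (bondAvgIter k A)
  | 0, _, _ => rfl
  | k + 1, t, A => by
    show bondAvg (bondAvgIter k (translV (Site.scaleTo k (Site.scale t)) A)) = translV t (bondAvg (bondAvgIter k A))
    rw [bondAvgIter_transl k (Site.scale t) A, bondAvg_transl]

/-- `Q′_k` commutes with the unit-lattice translations: `Q′_k(τ_{L^kt}λ) = τ_t(Q′_kλ)`. [cite: BalabanImbrieJaffe1985, (2.6) p.303] -/
theorem siteAvgIter_transl : ∀ (k : ℕ) (t : Balaban1983to89.Site P k) (f : SiteField P 0 V),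
    siteAvgIter k (translS (Site.scaleTo k t) f) = translS t (siteAvgIter k f)
  | 0, _, _ => rfl
  | k + 1, t, f => by
    show siteAvg (siteAvgIter k (translS (Site.scaleTo k (Site.scale t)) f)) = translS t (siteAvg (siteAvgIter k f))
    rw [siteAvgIter_transl k (Site.scale t) f, siteAvg_transl]

/-- **`δ_{k,Ax}` is carried into itself**: `δ_{k,Ax}(τ_{L^kt}A) = δ_{k,Ax}(A)` — every factor `δ_{Ax}(Q_jA)`, `j < k`, of (4.1.2)
(p09's `deltaAx`) is invariant, by `bondAvgIter_transl` and `isAxial_transl_iff` at level j. [cite: BalabanImbrieJaffe1985, (4.1.2) p.309] -/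
theorem deltaAx_transl_iff : ∀ (k : ℕ) (t : Balaban1983to89.Site P k) (A : VecField P 0 V),
    deltaAx k (translV (Site.scaleTo k t) A) ↔ deltaAx k A
  | 0, _, A => iff_of_true (deltaAx_zero _) (deltaAx_zero A)
  | k + 1, t, A => by
    rw [deltaAx_succ, deltaAx_succ, show Site.scaleTo (k + 1) t = Site.scaleTo k (Site.scale t) from rfl,
      deltaAx_transl_iff k (Site.scale t) A, bondAvgIter_transl k (Site.scale t) A, isAxial_transl_iff]

/-- **The support `δ(Q_kA)δ_{k,Ax}(A)` of (4.1.1) is invariant under the unit-lattice translations**: `τ_{L^kt}A ∈ constraint411 k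
↔ A ∈ constraint411 k` (p09's constraint subspace: `Q_kA = 0` and `δ_{k,Ax}(A)`). [cite: BalabanImbrieJaffe1985, (4.1.1) p.309] -/
theorem constraint411_transl_iff (k : ℕ) (t : Balaban1983to89.Site P k) (A : VecField P 0 V) :
    translV (Site.scaleTo k t) A ∈ (constraint411 k : Submodule ℝ (VecField P 0 V)) ↔
      A ∈ (constraint411 k : Submodule ℝ (VecField P 0 V)) := by
  rw [mem_constraint411, mem_constraint411, bondAvgIter_transl, deltaAx_transl_iff, translV_eq_zero_iff]

end Iterated

/-! ## §3  The edge pull-back `Q^{e*}` (2.22) and its k-fold composite `Q^{e*}_k` (2.24) -/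

/-- Membership in the edge sets `B^e(p′)` (2.21) of p31's torus geometry is translation covariant: `p + L·a ∈ B^e(p′ + a) ↔
p ∈ B^e(p′)` (blocks go to blocks, r09's `blockOf_add_scale`; standing range `j + 1 ≤ m + K`). [cite: BalabanImbrieJaffe1985, (2.21) p.305] -/
theorem mem_edgeB_transl_iff (hd : 2 ≤ P.d) (hj : j + 1 ≤ P.m + P.K) (a : Balaban1983to89.Site P (j + 1)) (p' : Plaq P (j + 1)) (p : Plaq P j) :
    p.translate (Site.scale a) ∈ (BIJ85CurlQsstar.torusEdgeCells P j hd).B (p'.translate a) ↔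
      p ∈ (BIJ85CurlQsstar.torusEdgeCells P j hd).B p' := by
  rw [BIJ85CurlQsstar.mem_edgeB_iff, BIJ85CurlQsstar.mem_edgeB_iff]
  obtain ⟨x, μ, ν, hμν⟩ := p
  obtain ⟨y, μ', ν', hμν'⟩ := p'
  simp only [Plaq.translate, Site.shift_add, blockOf_add_scale hj, add_left_inj]

/-- **`Q^{e*}` commutes with the block-lattice translations**: `(Q^{e*}(τ_ag))(p) = (Q^{e*}g)(p + L·a)` for the pull-back (2.22) of
p31's `torusEdgeCells` (standing range). [cite: BalabanImbrieJaffe1985, (2.22) p.305] -/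
theorem edgeQstar_transl (hd : 2 ≤ P.d) (hj : j + 1 ≤ P.m + P.K) (a : Balaban1983to89.Site P (j + 1)) (g : Plaq P (j + 1) → ℝ) (p : Plaq P j) :
    (BIJ85CurlQsstar.torusEdgeCells P j hd).Qstar (translP a g) p =
      (BIJ85CurlQsstar.torusEdgeCells P j hd).Qstar g (p.translate (Site.scale a)) := by
  unfold BIJ85CellAverages.Cells.Qstar
  conv_rhs => rw [← (Plaq.translateEquiv (P := P) (j := j + 1) a).sum_comp]
  refine Finset.sum_congr rfl fun p' _ => ?_
  have hiff := mem_edgeB_transl_iff hd hj a p' p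
  have he : Plaq.translateEquiv (P := P) (j := j + 1) a p' = p'.translate a := rfl
  rw [he]
  split_ifs with h1 h2 h2
  · rfl
  · exact absurd (hiff.2 h1) h2
  · exact absurd (hiff.1 h2) h1
  · rfl

/-- **`Q^{e*}_k` commutes with the unit-lattice translations**: `Q^{e*}_k(τ_tg) = τ_{L^kt}(Q^{e*}_kg)` for p30 g3's composite
`BIJ85Eq531Inputs.QestarIter` (induction on k through `Q^{e*}_{k+1} = Q^{e*}_kQ^{e*}`; standing range `k ≤ m + K`).
[cite: BalabanImbrieJaffe1985, (2.24) p.305] -/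
theorem QestarIter_transl (hd : 2 ≤ P.d) : ∀ (k : ℕ), k ≤ P.m + P.K → ∀ (t : Balaban1983to89.Site P k) (g : Plaq P k → ℝ),
    BIJ85Eq531Inputs.QestarIter hd k (translP t g) = translP (Site.scaleTo k t) (BIJ85Eq531Inputs.QestarIter hd k g)
  | 0, _, t, g => by simp
  | k + 1, hk, t, g => by
    rw [BIJ85Eq531Inputs.QestarIter_succ, BIJ85Eq531Inputs.QestarIter_succ]
    have h1 : (BIJ85CurlQsstar.torusEdgeCells P k hd).Qstar (translP t g) =
        translP (Site.scale t) ((BIJ85CurlQsstar.torusEdgeCells P k hd).Qstar g) :=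
      funext fun p => edgeQstar_transl hd hk t g p
    rw [h1, QestarIter_transl hd k (by omega) (Site.scale t)]
    rfl

/-! ## §4  *"σ_k is translation invariant"* on the torus model -/

section Sigma

open scoped RealInnerProductSpace
open BIJ85Sigma421Torus BIJ85Sigma422Equivariance BIJ85NoZeroModes309Torus

/-- Components of p09's `curlOp` (its own `curlOp_apply` is private). [folklore] -/
private theorem curlOp_apply' (w c : ℝ) (v : BondSpace P) (p : Plaq P 0) :
    curlOp (P := P) w c v p = Real.sqrt w * curl c ((toE P).symm v) p := rfl

/-- **The unit-lattice translation `τ_v` of η-bond vectors** (`v ∈ T^{(0)}`; for `t ∈ T^{(k)}` take `v = L^k·t = scaleTo k t`)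
as a linear ISOMETRY of p09's Euclidean space `BondSpace P` — the `U_E` of p27's `sigmaOp_equivariant`.
[cite: BalabanImbrieJaffe1985, Thm. 7.1.1 p.321] -/
def bondTransl (v : Balaban1983to89.Site P 0) : BondSpace P ≃ₗᵢ[ℝ] BondSpace P :=
  LinearIsometryEquiv.piLpCongrLeft 2 ℝ ℝ (PBond.translateEquiv v).symm

/-- `(τ_vA)(b) = A(b + v)`. [cite: BalabanImbrieJaffe1985, Thm. 7.1.1 p.321] -/
theorem bondTransl_apply (v : Balaban1983to89.Site P 0) (A : BondSpace P) (b : PBond P 0) :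
    bondTransl v A b = A (b.translate v) := by
  unfold bondTransl
  rw [LinearIsometryEquiv.piLpCongrLeft_apply, Equiv.piCongrLeft'_apply, Equiv.symm_symm]
  rfl

/-- The translation of η-plaquette vectors as a linear isometry of `PlaqSpace P` — the `U_F`. [cite: BalabanImbrieJaffe1985, Thm. 7.1.1 p.321] -/
def plaqTransl (v : Balaban1983to89.Site P 0) : PlaqSpace P ≃ₗᵢ[ℝ] PlaqSpace P :=
  LinearIsometryEquiv.piLpCongrLeft 2 ℝ ℝ (Plaq.translateEquiv v).symm

/-- `(τ_vg)(p) = g(p + v)`. [cite: BalabanImbrieJaffe1985, Thm. 7.1.1 p.321] -/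
theorem plaqTransl_apply (v : Balaban1983to89.Site P 0) (g : PlaqSpace P) (p : Plaq P 0) :
    plaqTransl v g p = g (p.translate v) := by
  unfold plaqTransl
  rw [LinearIsometryEquiv.piLpCongrLeft_apply, Equiv.piCongrLeft'_apply, Equiv.symm_symm]
  rfl

/-- The translation `τ_t`, `t ∈ T^{(k)}`, of unit-lattice plaquette vectors as a linear isometry of p30's `UnitPlaqSpace P k` —
the `U_{F′}`. [cite: BalabanImbrieJaffe1985, Thm. 7.1.1 p.321] -/
def unitPlaqTransl (k : ℕ) (t : Balaban1983to89.Site P k) : UnitPlaqSpace P k ≃ₗᵢ[ℝ] UnitPlaqSpace P k :=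
  LinearIsometryEquiv.piLpCongrLeft 2 ℝ ℝ (Plaq.translateEquiv t).symm

/-- `(τ_tf)(p) = f(p + t)`. [cite: BalabanImbrieJaffe1985, Thm. 7.1.1 p.321] -/
theorem unitPlaqTransl_apply (k : ℕ) (t : Balaban1983to89.Site P k) (f : UnitPlaqSpace P k) (p : Plaq P k) :
    unitPlaqTransl k t f p = f (p.translate t) := by
  unfold unitPlaqTransl
  rw [LinearIsometryEquiv.piLpCongrLeft_apply, Equiv.piCongrLeft'_apply, Equiv.symm_symm]
  rfl

/-- Under p09's identification `toE`, `bondTransl v` is `translV v`. [cite: BalabanImbrieJaffe1985, Thm. 7.1.1 p.321] -/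
theorem toE_symm_bondTransl (v : Balaban1983to89.Site P 0) (A : BondSpace P) :
    (toE P).symm (bondTransl v A) = translV v ((toE P).symm A) := by
  funext b
  show bondTransl v A b = A (b.translate v)
  exact bondTransl_apply v A b

/-- **The support `δ(Q_kA)δ_{k,Ax}(A)` is invariant**: `τ_{L^kt}A ∈ V411 P k ↔ A ∈ V411 P k` (p09's subspace; §2's
`constraint411_transl_iff` transported). [cite: BalabanImbrieJaffe1985, (4.1.1) p.309] -/
theorem bondTransl_mem_V411_iff (k : ℕ) (t : Balaban1983to89.Site P k) (A : BondSpace P) :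
    bondTransl (Site.scaleTo k t) A ∈ V411 P k ↔ A ∈ V411 P k := by
  rw [mem_V411, mem_V411, toE_symm_bondTransl, bondAvgIter_transl, deltaAx_transl_iff, translV_eq_zero_iff]

/-- **`∂` intertwines the translations**: `curlOp(τ_vA) = τ_v(curlOp A)`. [cite: BalabanImbrieJaffe1985, (4.2.2) p.310] -/
theorem curlOp_bondTransl (w c : ℝ) (v : Balaban1983to89.Site P 0) (A : BondSpace P) :
    curlOp (P := P) w c (bondTransl v A) = plaqTransl v (curlOp (P := P) w c A) := by
  ext p
  rw [plaqTransl_apply, curlOp_apply', curlOp_apply', toE_symm_bondTransl, curl_transl]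

/-- **`Q^{e*}_k` intertwines the translations**: `QesOp(τ_tf) = τ_{L^kt}(QesOp f)` (p30's `QesOp` = `√(η^d)·Q^{e*}_k`; standing
range `k ≤ m + K`). [cite: BalabanImbrieJaffe1985, (4.2.2) p.310] -/
theorem QesOp_unitPlaqTransl (hd : 2 ≤ P.d) {k : ℕ} (hk : k ≤ P.m + P.K) (w : ℝ) (t : Balaban1983to89.Site P k)
    (f : UnitPlaqSpace P k) :
    QesOp (P := P) hd w k (unitPlaqTransl k t f) = plaqTransl (Site.scaleTo k t) (QesOp (P := P) hd w k f) := by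
  ext p
  rw [plaqTransl_apply, QesOp_apply, QesOp_apply]
  have h : (fun q => unitPlaqTransl k t f q) = translP t (fun q => f q) := funext fun q => unitPlaqTransl_apply k t f q
  rw [h, QestarIter_transl hd k hk t]
  rfl

/-- **"Since we study periodic boundary conditions, σ_k is translation invariant"** ON THE TORUS MODEL: for every `t ∈ T^{(k)}`,
`σ_k(τ_tf) = τ_t(σ_kf)` for p30 g3's `sigmaTorus` = (4.2.2) at the torus data — p27 g4's `sigmaOp_equivariant` with its three
hypotheses DISCHARGED: `U_E V411 = V411` (`bondTransl_mem_V411_iff`), `∂U_E = U_F∂` (`curlOp_bondTransl`), `Q^{e*}_kU_{F′} =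
U_FQ^{e*}_k` (`QesOp_unitPlaqTransl`), and the no-zero-modes hypothesis by gen 2's `noZeroModes_V411_holds` (`k ≤ m + K`,
`η^d = w > 0`, `c ≠ 0`). [cite: BalabanImbrieJaffe1985, Thm. 7.1.1 p.321] -/
theorem sigmaTorus_translate (hd : 2 ≤ P.d) {k : ℕ} (hk : k ≤ P.m + P.K) {w : ℝ} (hw : 0 < w) {c : ℝ} (hc : c ≠ 0)
    (t : Balaban1983to89.Site P k) (f : UnitPlaqSpace P k) :
    sigmaTorus (P := P) hd w c k (unitPlaqTransl k t f) = unitPlaqTransl k t (sigmaTorus (P := P) hd w c k f) := by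
  unfold sigmaTorus
  exact sigmaOp_equivariant (noZeroModes_V411_holds hk hw hc) (bondTransl (Site.scaleTo k t))
    (plaqTransl (Site.scaleTo k t)) (unitPlaqTransl k t) (fun x hx => (bondTransl_mem_V411_iff k t x).2 hx)
    (fun x hx => (bondTransl_mem_V411_iff k t _).1 (by rwa [LinearIsometryEquiv.apply_symm_apply]))
    (curlOp_bondTransl w c (Site.scaleTo k t)) (QesOp_unitPlaqTransl hd hk w t) f

/-- … hence the quadratic form `⟨f, σ_kf⟩` of (4.2.1) is translation invariant: `⟨τ_tf, σ_k(τ_tg)⟩ = ⟨f, σ_kg⟩`.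
[cite: BalabanImbrieJaffe1985, Thm. 7.1.1 p.321] -/
theorem inner_sigmaTorus_translate (hd : 2 ≤ P.d) {k : ℕ} (hk : k ≤ P.m + P.K) {w : ℝ} (hw : 0 < w) {c : ℝ} (hc : c ≠ 0)
    (t : Balaban1983to89.Site P k) (f g : UnitPlaqSpace P k) :
    ⟪unitPlaqTransl k t f, sigmaTorus (P := P) hd w c k (unitPlaqTransl k t g)⟫ = ⟪f, sigmaTorus (P := P) hd w c k g⟫ := by
  rw [sigmaTorus_translate hd hk hw hc, LinearIsometryEquiv.inner_map_map]

/-- Componentwise: `(σ_k(τ_tf))(p) = (σ_kf)(p + t)`. [cite: BalabanImbrieJaffe1985, Thm. 7.1.1 p.321] -/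
theorem sigmaTorus_translate_apply (hd : 2 ≤ P.d) {k : ℕ} (hk : k ≤ P.m + P.K) {w : ℝ} (hw : 0 < w) {c : ℝ} (hc : c ≠ 0)
    (t : Balaban1983to89.Site P k) (f : UnitPlaqSpace P k) (p : Plaq P k) :
    sigmaTorus (P := P) hd w c k (unitPlaqTransl k t f) p = sigmaTorus (P := P) hd w c k f (p.translate t) := by
  rw [sigmaTorus_translate hd hk hw hc, unitPlaqTransl_apply]

/-- `(p + t) − t = p` for plaquettes. [folklore] -/
private theorem translate_translate_neg {k : ℕ} (t : Balaban1983to89.Site P k) (p : Plaq P k) :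
    (p.translate t).translate (-t) = p := by
  obtain ⟨x, μ, ν, h⟩ := p
  simp [Plaq.translate]

/-- The translate of a coordinate vector: `τ_tδ_q = δ_{q−t}`. [cite: BalabanImbrieJaffe1985, Thm. 7.1.1 p.321] -/
theorem unitPlaqTransl_single {k : ℕ} [DecidableEq (Plaq P k)] (t : Balaban1983to89.Site P k) (q : Plaq P k) :
    unitPlaqTransl k t (EuclideanSpace.single q (1 : ℝ)) = EuclideanSpace.single (q.translate (-t)) 1 := by
  ext p
  rw [unitPlaqTransl_apply]
  have h : p.translate t = q ↔ p = q.translate (-t) := (Plaq.translateEquiv t).apply_eq_iff_eq_symm_apply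
  simp [PiLp.single_apply, h]

/-- **The kernel statement** (the shape of p27's `BIJ85Eq712Plancherel.IsTranslInv`): the matrix of `σ_k` in the plaquette
basis, `σ_k(p, q) = ⟨δ_p, σ_kδ_q⟩`, satisfies `σ_k(p + t, q + t) = σ_k(p, q)` for every `t ∈ T^{(k)}` — σ_k is a convolution
operator on the unit torus. [cite: BalabanImbrieJaffe1985, (7.1.2) p.321] -/
theorem sigmaTorus_matrix_translate (hd : 2 ≤ P.d) {k : ℕ} [DecidableEq (Plaq P k)] (hk : k ≤ P.m + P.K) {w : ℝ}
    (hw : 0 < w) {c : ℝ} (hc : c ≠ 0) (t : Balaban1983to89.Site P k) (p q : Plaq P k) :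
    ⟪EuclideanSpace.single (p.translate t) (1 : ℝ), sigmaTorus (P := P) hd w c k (EuclideanSpace.single (q.translate t) 1)⟫ =
      ⟪EuclideanSpace.single p (1 : ℝ), sigmaTorus (P := P) hd w c k (EuclideanSpace.single q 1)⟫ := by
  have hp : unitPlaqTransl k t (EuclideanSpace.single (p.translate t) (1 : ℝ)) = EuclideanSpace.single p 1 := by
    rw [unitPlaqTransl_single, translate_translate_neg]
  have hq : unitPlaqTransl k t (EuclideanSpace.single (q.translate t) (1 : ℝ)) = EuclideanSpace.single q 1 := by
    rw [unitPlaqTransl_single, translate_translate_neg]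
  rw [← inner_sigmaTorus_translate hd hk hw hc t (EuclideanSpace.single (p.translate t) (1 : ℝ)), hp, hq]

end Sigma

end

end Literature.MathematicalPhysics.QuantumFieldTheory.BalabanImbrieJaffe1984to88.BIJ85SigmaTranslationInvariance
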